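import Summits.Ventures.GridStability.Models.WSCC9SplitLurie
import Literature.MathematicalPhysics.PowerSystems.LossyMultimachineLurieSplitLines

/-!
# GridStability/Models/WSCC9SplitLurieLines — model-1's classical model WITH transfer conductances AS lit-6's
# UNORDERED-LINES split Lur'e system (Pai (3.43)–(3.45): one sine + one cosine channel per LINE `p < q` feeding
# BOTH machines, rational data) + the slab-certificate ROA sentence for «WSCC9-postB-SPdamp-h12»

Cell `gridfusion` (LADDER-GRIDFUSION G2.c lossy tier); seat gridfusion-lit-6 (g9), item «SPLITU-8°».  The THIRD
presentation of the same printed model as a Lur'e system: `Models/ClassicalSwingLurie.lean` (lane V: directed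
polar form `WSCC9.lurieSystem`, irrational weights), `Models/WSCC9SplitLurie.lean` (lane F1: ORDERED split,
each ordered pair feeds its source machine), and THIS file (lit-6 `LossyMultimachineLurieSplitLines.lean`
p510572: UNORDERED lines, sine line `(p,q)`, `p < q`, feeds `+C_pq/M_p` to machine `p` and `−C_qp/M_q` to
machine `q`; cosine line feeds `+D_pq/M_p` and `+D_qp/M_q`; the columns with `p ≥ q` are ZERO).  States,
channels, `A`, `C`, `δ*`, `lurieState` are LITERALLY those of the ordered split (`toSplitLurieLines_A/_C/_δs`
are `rfl`); only `B` differs.  WHY (VALIDATED census of record, sos-2 g4 07:11Z / lead R-LOSSY-SLAB-ROW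
AMENDMENT 2 07:12:06Z): for the Lur'e–Postnikov slab class the three presentations are NOT equivalent LMI
feasibility problems — on «WSCC9-postB-SPdamp-h12» the ordered split is feasible to ≈ 3°, the directed polar
class is kernel-CAPPED at 7.552° / 7.666° (`WSCC9LossySlabDual33`, `WSCC9LossySlabLPDual`), and the
unordered-lines split is feasible at 8.008° (sos-2 exact object `WSCC9SPLITU-slab-u7o100`, typed in
`Lyapunov/WSCC9LossySplitLines{Data,Cast}` / `Bench/WSCC9LossySplitLinesRoa`).

CONTENTS (identities only; nothing CERTIFIED here): generic `RecastData.splitLurieLinesSystem`, the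
HYPOTHESIS-FREE bridge `RecastData.hasDerivWithinAt_lurieState_lines` (every solution of `d.toModel` drives
`lurieState` along `(d.splitLurieLinesSystem δˢ).field`; only the A1 data `EqData`), the packaged sentence
`RecastData.lossy_splitLines_roa` (lit-6 `InternalNode.lurieState_tendsto_zero_of_slabCertificate_lines`
transported), and the instance «WSCC9-postB-SPdamp-h12»: `WSCC9.splitLurieLinesSystem`,
`WSCC9.hasDerivWithinAt_lurieState_lines`, `WSCC9.lossy_splitLines_roa` (conditional ONLY on the certificate
facts).  MODELLED: as `WSCC9.postB_SPdamp` (MV-2 + MV-P + MV-SPD + MV-ω + MV-h12; transfer conductances KEPT).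
No sentence here says a grid is stable.
[cite: Pai1981, §3.6.3 eqs. (3.43)–(3.45); VuTuritsyn2017, §4.3 Theorem 1]
-/

noncomputable section

open Real Set Filter Topology Finset
open Literature.MathematicalPhysics.PowerSystems
open Literature.MathematicalPhysics.PowerSystems.LyapunovFunctionFamily (SlabCertificate)

namespace Summit.Ventures.GridStability.Models

namespace RecastData

variable {n : ℕ} (d : RecastData n) {δs : Fin (n + 1) → ℝ}

/-- The UNORDERED-LINES split Lur'e system of the recast model at an equilibrium `δˢ`: lit-6's
`toSplitLurieLines` of `toModel.toLitNode` (one sine and one cosine channel per line `p < q` feeding both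
machines; rational weights `C_pq`, `D_pq`; columns `p ≥ q` zero). [cite: Pai1981, §3.6.3 eqs. (3.43)–(3.45)] -/
def splitLurieLinesSystem (δs : Fin (n + 1) → ℝ) :
    LyapunovFunctionFamily.System (Fin (n + 1) ⊕ Fin n)
      ((Fin (n + 1) × Fin (n + 1)) ⊕ (Fin (n + 1) × Fin (n + 1))) :=
  d.toModel.toLitNode.toSplitLurieLines δs

/-- Same `A` as the ordered split presentation (definitional). [cite: Pai1981, §3.6.3 eq. (3.45)] -/
theorem splitLurieLinesSystem_A (δs : Fin (n + 1) → ℝ) :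
    (d.splitLurieLinesSystem δs).A = (d.splitLurieSystem δs).A := rfl

/-- Same `C` as the ordered split presentation (definitional). [cite: Pai1981, §3.6.3 eq. (3.43)] -/
theorem splitLurieLinesSystem_C (δs : Fin (n + 1) → ℝ) :
    (d.splitLurieLinesSystem δs).C = (d.splitLurieSystem δs).C := rfl

/-- Same `δ*` as the ordered split presentation (definitional). [cite: Pai1981, §3.6.3 eq. (3.44)] -/
theorem splitLurieLinesSystem_δs (δs : Fin (n + 1) → ℝ) :
    (d.splitLurieLinesSystem δs).δs = (d.splitLurieSystem δs).δs := rfl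

/-- Hence the same slab. [cite: Pai1981, §3.6.3 eq. (3.43)] -/
theorem splitLurieLinesSystem_slab (δs : Fin (n + 1) → ℝ)
    (γ : (Fin (n + 1) × Fin (n + 1)) ⊕ (Fin (n + 1) × Fin (n + 1)) → ℝ) :
    (d.splitLurieLinesSystem δs).slab γ = (d.splitLurieSystem δs).slab γ := rfl

/-- **THE BRIDGE (unordered-lines presentation, chain rule).** Along EVERY solution `c` of `d.toModel` on
`univ` (transfer conductances kept, damping as typed), with A1 data `δˢ`, the Lur'e state
`t ↦ lurieState δˢ (c t)` solves `ẋ = (d.splitLurieLinesSystem δˢ).field x` within every time set.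
[cite: Pai1981, §3.6.3 eq. (3.45)] -/
theorem hasDerivWithinAt_lurieState_lines (hE : d.EqData δs) {c : ℝ → ClassicalSwing.State (n + 1)}
    (hc : d.toModel.IsSolutionOn c univ) {s : Set ℝ} (t : ℝ) :
    HasDerivWithinAt (fun τ => d.lurieState δs (c τ))
      ((d.splitLurieLinesSystem δs).field (d.lurieState δs (c t))) s t :=
  d.toModel.toLitNode.hasDerivWithinAt_lurieState_lines
    ((d.toModel.toLitNode_isEquilibrium_iff δs).2 (d.isEquilibrium_of_eqData hE))
    (d.toModel.isSolutionAt_toLitNode hc t)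

/-- **ROA of the recast classical model WITH transfer conductances from an exact SLAB certificate on the
unordered-lines split presentation** (lit-6 `InternalNode.lurieState_tendsto_zero_of_slabCertificate_lines`
transported through `toModel.toLitNode`): A1 data `δˢ`, an exact `Λ : SlabCertificate (d.splitLurieLinesSystem δˢ)`,
per-channel sector facts on the slab `γ`, rank-one facts `s_k` and a level `c < γ_k²/s_k` ⇒ every solution of
`d.toModel` on `univ` whose initial Lur'e state is in `{slab γ, V ≤ c}` keeps it for all `t ≥ 0` and has
`lurieState → 0` (all speed deviations `→ 0`, all `δ_p − δ₀ → δˢ_p − δˢ₀`).  No observability hypothesis.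
[cite: Pai1981, §2.16 Theorem [18], §3.6.3 eqs. (3.43)–(3.45); VuTuritsyn2017, §4.3 Theorem 1] -/
theorem lossy_splitLines_roa (hE : d.EqData δs) (Λ : SlabCertificate (d.splitLurieLinesSystem δs))
    {γ : (Fin (n + 1) × Fin (n + 1)) ⊕ (Fin (n + 1) × Fin (n + 1)) → ℝ}
    (hsec : ∀ k ξ, |ξ - InternalNode.splitShift δs k| ≤ γ k → Λ.a k ≤ Real.cos ξ ∧ Real.cos ξ ≤ Λ.b k)
    {sk : (Fin (n + 1) × Fin (n + 1)) ⊕ (Fin (n + 1) × Fin (n + 1)) → ℝ} (hs0 : ∀ k, 0 < sk k)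
    (hs : ∀ k, (sk k • Λ.P - Matrix.vecMulVec ((d.splitLurieLinesSystem δs).C k)
      ((d.splitLurieLinesSystem δs).C k)).PosSemidef)
    {lev : ℝ} (hlev : ∀ k, lev < γ k ^ 2 / sk k)
    {c : ℝ → ClassicalSwing.State (n + 1)} (hc : d.toModel.IsSolutionOn c univ)
    (h0 : d.lurieState δs (c 0) ∈ (d.splitLurieLinesSystem δs).slab γ)
    (h0c : Λ.V (d.lurieState δs (c 0)) ≤ lev) :
    (∀ t, 0 ≤ t → d.lurieState δs (c t) ∈ (d.splitLurieLinesSystem δs).slab γ ∧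
        Λ.V (d.lurieState δs (c t)) ≤ lev) ∧
      Tendsto (fun t => d.lurieState δs (c t)) atTop (𝓝 0) :=
  d.toModel.toLitNode.lurieState_tendsto_zero_of_slabCertificate_lines
    ((d.toModel.toLitNode_isEquilibrium_iff δs).2 (d.isEquilibrium_of_eqData hE)) Λ hsec hs0 hs hlev
    (fun t _ => d.toModel.isSolutionAt_toLitNode hc t) h0 h0c

end RecastData

/-! ### Instance of record «WSCC9-postB-SPdamp-h12» (transfer conductances KEPT), unordered-lines split -/

namespace WSCC9

/-- The UNORDERED-LINES split Lur'e system of the instance of record at its A1 equilibrium (18 channels: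
9 sine, 9 cosine; ACTIVE = the three lines `(0,1)`, `(0,2)`, `(1,2)` in each family, the other 12 columns of
`B` are zero; rational `A`, `B`, `C`). [cite: Pai1981, §3.6.3 eq. (3.45)] -/
def splitLurieLinesSystem :
    LyapunovFunctionFamily.System (Fin 3 ⊕ Fin 2) ((Fin 3 × Fin 3) ⊕ (Fin 3 × Fin 3)) :=
  postB_SPdamp.splitLurieLinesSystem postB_SPdamp.angleOf

/-- Same `A` as `WSCC9.splitLurieSystem` (definitional). [cite: Pai1981, §3.6.3 eq. (3.45)] -/
theorem splitLurieLinesSystem_A : splitLurieLinesSystem.A = splitLurieSystem.A := rfl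

/-- Same `C` as `WSCC9.splitLurieSystem` (definitional). [cite: Pai1981, §3.6.3 eq. (3.43)] -/
theorem splitLurieLinesSystem_C : splitLurieLinesSystem.C = splitLurieSystem.C := rfl

/-- Same `δ*` as `WSCC9.splitLurieSystem` (definitional). [cite: Pai1981, §3.6.3 eq. (3.44)] -/
theorem splitLurieLinesSystem_δs : splitLurieLinesSystem.δs = splitLurieSystem.δs := rfl

/-- Same slab as `WSCC9.splitLurieSystem` (definitional). [cite: Pai1981, §3.6.3 eq. (3.43)] -/
theorem splitLurieLinesSystem_slab (γ : (Fin 3 × Fin 3) ⊕ (Fin 3 × Fin 3) → ℝ) :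
    splitLurieLinesSystem.slab γ = splitLurieSystem.slab γ := rfl

/-- `B` of the unordered-lines system is lit-6's `lineInput` over the state split (definitional unfolding).
[cite: Pai1981, §3.6.3 eq. (3.45) (the matrices B₁, B₂)] -/
theorem splitLurieLinesSystem_B : splitLurieLinesSystem.B =
    Matrix.fromRows postB_SPdamp.toModel.toLitNode.lineInput 0 := rfl

/-- **HYPOTHESIS-FREE bridge for the instance of record (unordered-lines presentation)**: every solution of
`WSCC9.postB_SPdamp.toModel` on `univ` drives the Lur'e state along `WSCC9.splitLurieLinesSystem`.
[cite: Pai1981, §3.6.3 eq. (3.45)] -/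
theorem hasDerivWithinAt_lurieState_lines {c : ℝ → ClassicalSwing.State 3}
    (hc : postB_SPdamp.toModel.IsSolutionOn c univ) {s : Set ℝ} (t : ℝ) :
    HasDerivWithinAt (fun τ => postB_SPdamp.lurieState postB_SPdamp.angleOf (c τ))
      (splitLurieLinesSystem.field (postB_SPdamp.lurieState postB_SPdamp.angleOf (c t))) s t :=
  postB_SPdamp.hasDerivWithinAt_lurieState_lines postB_SPdamp_eqData hc t

/-- **The lossy-tier ROA sentence for «WSCC9-postB-SPdamp-h12» on the UNORDERED-LINES split presentation,
CONDITIONAL ONLY ON THE CERTIFICATE**: for every exact `Λ : SlabCertificate WSCC9.splitLurieLinesSystem` with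
per-channel sector facts on a slab `γ` (from `sector_sin_of_values` / `sector_cos_of_values` and
`sin_angleOf_sub` / `cos_angleOf_sub`; null channels `a = −1`, `b = 1`), rank-one facts `s_k` and a level
`lev < γ_k²/s_k`, EVERY solution of the printed post-B classical model (transfer conductances kept,
D/M = 1/10, 1/5, 3/10) starting in `{slab, V ≤ lev}` keeps it and synchronises: all `ω_i → 0`,
`δ_m − δ_1 → θ*_m`.  MODELLED «WSCC9-postB-SPdamp-h12»; the certificate is sos-2's unordered split object,
typed in `Lyapunov/WSCC9LossySplitLinesCast`. [cite: Pai1981, §3.6.3 eqs. (3.43)–(3.45); VuTuritsyn2017, §4.3 Theorem 1] -/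
theorem lossy_splitLines_roa (Λ : SlabCertificate splitLurieLinesSystem)
    {γ : (Fin 3 × Fin 3) ⊕ (Fin 3 × Fin 3) → ℝ}
    (hsec : ∀ k ξ, |ξ - InternalNode.splitShift postB_SPdamp.angleOf k| ≤ γ k →
      Λ.a k ≤ Real.cos ξ ∧ Real.cos ξ ≤ Λ.b k)
    {sk : (Fin 3 × Fin 3) ⊕ (Fin 3 × Fin 3) → ℝ} (hs0 : ∀ k, 0 < sk k)
    (hs : ∀ k, (sk k • Λ.P
      - Matrix.vecMulVec (splitLurieLinesSystem.C k) (splitLurieLinesSystem.C k)).PosSemidef)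
    {lev : ℝ} (hlev : ∀ k, lev < γ k ^ 2 / sk k)
    {c : ℝ → ClassicalSwing.State 3} (hc : postB_SPdamp.toModel.IsSolutionOn c univ)
    (h0 : postB_SPdamp.lurieState postB_SPdamp.angleOf (c 0) ∈ splitLurieLinesSystem.slab γ)
    (h0c : Λ.V (postB_SPdamp.lurieState postB_SPdamp.angleOf (c 0)) ≤ lev) :
    (∀ t, 0 ≤ t → postB_SPdamp.lurieState postB_SPdamp.angleOf (c t) ∈ splitLurieLinesSystem.slab γ ∧
        Λ.V (postB_SPdamp.lurieState postB_SPdamp.angleOf (c t)) ≤ lev) ∧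
      Tendsto (fun t => postB_SPdamp.lurieState postB_SPdamp.angleOf (c t)) atTop (𝓝 0) :=
  postB_SPdamp.lossy_splitLines_roa postB_SPdamp_eqData Λ hsec hs0 hs hlev hc h0 h0c

end WSCC9

end Summit.Ventures.GridStability.Models

end
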